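import Summits.BirchSwinnertonDyer.Rank1Residual.X12.InertBadKodairaTypes
import Summits.BirchSwinnertonDyer.Rank1Residual.Partition.CornersCMDecide
import Literature.NumberTheory.EllipticCurves.MordellCurveThreeDescentLocalRat
import Literature.NumberTheory.EllipticCurves.ComplexMultiplicationDeuring0Square
import Mathlib.NumberTheory.LegendreSymbol.Basic
import HarnessLib

/-!
# The LOCAL TYPES `(p, e)` of the X12 inert-bad core: `e ∣ p + 1`
# (CLASS-CLOSURE §3.14 / O10: the parameter space of the missing local statement `(Rubin_η)`)

HONEST FRAMING (cell `b2b-bsdres`, run/shared/lean/b2b/bsd-rank1-residual/, verbatim in every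
file): the goal of the cell is to DELETE the COMBINATION-SHAPED residual classes of the
Birch–Swinnerton-Dyer formula for ALL analytic-rank `≤ 1` elliptic curves over `ℚ` — "full BSD
formula for every rank `≤ 1` curve in class `C`" assembled STRICTLY from published theorems — so
that the rank-`≤ 1` remainder becomes exactly the CONSTRUCTION-SHAPED classes, which are TYPED
(missing-input `Prop`s), NOT attempted. This is not "finishing BSD". Unit `b2b-bsdres-x1b` (X12
prover owner), generation 24; research route, no claim beyond the stated class; X12 REMAINS
CONSTRUCTION-SHAPED; nothing is booked here — booking is the lane's and the referee's.

Theorems only; no definition, no new named fact. Kernel form of O10-TARGET §1 (i) (HOME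
`b2b-bsdres-x1b/gen23/O10-TARGET.md`; checked there numerically on all 995 inert-bad pairs
`N < 5·10⁵`, here PROVED): on the X12 inert-bad core — CM, `r_an = 1`, `p ≥ 5` BAD, `p` INERT in the
CM field `K` — the semistability defect `e ∈ {2, 3, 4, 6}` of the pair (read off the Kodaira type at
`p`: `I₀* ↦ 2`, `IV, IV* ↦ 3`, `III, III* ↦ 4`, `II, II* ↦ 6`; gen 23 `kodairaSymbolAt_of_classX12_of_bad`)
DIVIDES `p + 1`. Reason: `e ∈ {3, 6}` forces `j = 0`, `K = ℚ(√−3)`, and `p` inert in `ℚ(√−3)` is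
`p ≡ 2 (mod 3)` (§1, `cmInert_iff_mod_three_eq_two_of_j_eq_zero`); `e = 4` forces `j = 1728`,
`K = ℚ(i)`, and `p` inert in `ℚ(i)` is `p ≡ 3 (mod 4)` (§1, `cmInert_iff_mod_four_eq_three_of_j_eq_1728`);
`p` is odd. Consequence for the class (memo §2): the tame character `χ_p` of the pair, of order `e`,
factors through `𝔽_{p²}^× / 𝔽_p^×` (order `p + 1`), so the missing local statement `(Rubin_η)`,
`η = κ·χ_p`, is indexed by `(p, e, ±)` with `e ∣ p + 1` — at most four local problems per prime
(§2, `localType_of_classX12_of_cmInert`, `semistabilityDefect_dvd_succ_of_classX12_of_cmInert`).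
Census companion (evidence, not a theorem): HOME `b2b-bsdres-x1b/gen23/e2/O10-O11-SUBPARTITION.tsv`
(72 local types over 29 primes `p ≤ 173` in Cremona's range). Not claimed: anything at `p ∣ d_K`,
`p ∈ {2, 3}`, or about BSD.

References: [SilvermanATAEC1994] IV.9.4, Table 4.1, App. A §3; [Cox2013] Prop. 5.16 / Cor. 5.17
(splitting of `p` in `ℚ(√d_K)` by the Legendre symbol); [IrelandRosen1990] Prop. 5.1.2 / §9.1
(`−1`, `−3` as residues); HOME `CLASS-CLOSURE-PLAN.md` §3.14, `X12-ROUTE.md` §28.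
-/

noncomputable section

open scoped Classical NumberField

open WeierstrassCurve NumberField IsDedekindDomain IsDedekindDomain.HeightOneSpectrum
  Rat.HeightOneSpectrum Literature.NumberTheory.EllipticCurves
  Literature.NumberTheory.EllipticCurves.Rank1Residual
  Literature.NumberTheory.DiophantineGeometry
  Literature.NumberTheory.DiophantineGeometry.TateAlgorithm

namespace Summit.BirchSwinnertonDyer.Rank1Residual.X12

/-! ### §1 Inertness of `p` in `ℚ(√−3)` and `ℚ(i)` as a congruence -/

section Arithmetic

variable {p : ℕ} [hp : Fact p.Prime]

/-- `−3` is a square modulo a prime `p ≡ 1 (mod 3)` (`(2ω+1)² = −3` for `ω` of order `3` in `𝔽_pˣ`).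
[cite: IrelandRosen1990, §9.1 (proof of Prop. 9.1.4) and Prop. 5.1.2] -/
theorem isSquare_neg_three_of_mod_three_eq_one (h : p % 3 = 1) : IsSquare (-3 : ZMod p) := by
  obtain ⟨θ, hθ⟩ := MordellDescent.zmod_exists_sq_eq_neg_three (p := p) h
  exact ⟨θ, by rw [← hθ, sq]⟩

/-- `−3` is NOT a square modulo a prime `p ≡ 2 (mod 3)`, `p ≠ 2` (else `ω = (θ − 1)/2` would be a
non-trivial cube root of unity, but cubing is a bijection of `𝔽_p`). [cite: IrelandRosen1990, §9.1 and Prop. 5.1.2] -/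
theorem not_isSquare_neg_three_of_mod_three_eq_two (hp2 : p ≠ 2) (h3 : p % 3 = 2) :
    ¬ IsSquare (-3 : ZMod p) := by
  have hpr : p.Prime := hp.out
  have hp3 : p ≠ 3 := by rintro rfl; norm_num at h3
  obtain ⟨h2', h3'⟩ := two_three_ne_zero_zmod hpr hp2 hp3
  rintro ⟨θ, hθ⟩
  set ω : ZMod p := (θ - 1) / 2 with hω
  have hθω : θ = 2 * ω + 1 := by rw [hω]; field_simp; ring
  have hq : ω ^ 2 + ω + 1 = 0 := by
    have hsq : (2 * ω + 1) * (2 * ω + 1) = -3 := by rw [← hθω]; exact hθ.symm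
    have h4 : (2 * 2 : ZMod p) * (ω ^ 2 + ω + 1) = 0 := by linear_combination hsq
    exact (mul_eq_zero.mp h4).resolve_left (mul_ne_zero h2' h2')
  have hω3 : ω ^ 3 = 1 := by linear_combination (ω - 1) * hq
  have hinj := (pow_three_bijective_of_mod_three_eq_two (p := p) h3).1
  have hω1 : ω = 1 := hinj (by simp only [hω3, one_pow])
  rw [hω1] at hq
  exact h3' (by linear_combination hq)

/-- `−1` is NOT a square modulo a prime `p` iff `p ≡ 3 (mod 4)` (Mathlib
`ZMod.exists_sq_eq_neg_one_iff`), transported to `−4 = 2²·(−1)` at odd `p`.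
[cite: IrelandRosen1990, Prop. 5.1.2 and its Corollary] -/
theorem isSquare_neg_four_iff (hp2 : p ≠ 2) : IsSquare (-4 : ZMod p) ↔ p % 4 ≠ 3 := by
  have hpr : p.Prime := hp.out
  have h2' : (2 : ZMod p) ≠ 0 := by
    intro h0
    have h0' : ((2 : ℕ) : ZMod p) = 0 := by exact_mod_cast h0
    rw [ZMod.natCast_eq_zero_iff] at h0'
    exact hp2 ((Nat.prime_dvd_prime_iff_eq hpr Nat.prime_two).mp h0')
  rw [← ZMod.exists_sq_eq_neg_one_iff]
  constructor
  · rintro ⟨r, hr⟩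
    exact ⟨r / 2, by field_simp; linear_combination hr⟩
  · rintro ⟨r, hr⟩
    exact ⟨2 * r, by linear_combination (4 : ZMod p) * hr⟩

end Arithmetic

section CMField

variable (W : WeierstrassCurve ℚ) [W.IsElliptic] (p : ℕ) [hp : Fact p.Prime]

omit hp in
/-- A prime `p > q > 0` does not divide `−q`. [folklore] -/
private theorem not_dvd_neg_of_lt {q : ℕ} (hq : 0 < q) (hqp : q < p) : ¬ (p : ℤ) ∣ -(q : ℤ) := by
  intro h
  have h' : p ∣ q := by exact_mod_cast (dvd_neg.mp h)
  exact absurd (Nat.le_of_dvd hq h') (not_le.mpr hqp)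

/-- **`p` inert in `ℚ(√−3)` ⟺ `p ≡ 2 (mod 3)`** for a curve with `j = 0` (CM field `ℚ(√−3)`,
`d_K = −3`) and a prime `p ∉ {2, 3}`: `CMInert` unfolds to "`p ∤ −3` and `−3` is not a square mod `p`".
[cite: Cox2013, Prop. 5.16 and Cor. 5.17] [cite: IrelandRosen1990, Prop. 5.1.2 and §9.1] -/
theorem cmInert_iff_mod_three_eq_two_of_j_eq_zero (hp2 : p ≠ 2) (hp3 : p ≠ 3) (hj : W.j = 0) :
    CMInert W p ↔ p % 3 = 2 := by
  have hpr : p.Prime := hp.out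
  have hd : cmFieldDiscrOfJ W.j = -3 := by rw [hj]; norm_num [cmFieldDiscrOfJ]
  have hcast : ((cmFieldDiscrOfJ W.j : ℤ) : ZMod p) = -3 := by rw [hd]; push_cast; ring
  have hndvd : ¬ (p : ℤ) ∣ cmFieldDiscrOfJ W.j := by
    rw [hd]
    exact not_dvd_neg_of_lt p (q := 3) (by norm_num) (by have := hpr.two_le; omega)
  have h30 : p % 3 ≠ 0 := fun h0 ↦ by
    have h3p : 3 ∣ p := Nat.dvd_of_mod_eq_zero h0
    rcases (Nat.dvd_prime hpr).mp h3p with h | h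
    · norm_num at h
    · exact hp3 h.symm
  unfold CMInert CMRamified
  rw [not_cmSplit_iff_of_ne_two hp2, hcast]
  constructor
  · rintro ⟨-, h | h⟩
    · exact absurd h hndvd
    · by_contra hne
      exact h (isSquare_neg_three_of_mod_three_eq_one (by omega))
  · exact fun h ↦ ⟨hndvd, Or.inr (not_isSquare_neg_three_of_mod_three_eq_two hp2 h)⟩

/-- **`p` inert in `ℚ(i)` ⟺ `p ≡ 3 (mod 4)`** for a curve with `j = 1728` (CM field `ℚ(i)`,
`d_K = −4`) and an odd prime `p`. [cite: Cox2013, Prop. 5.16 and Cor. 5.17] [cite: IrelandRosen1990, Prop. 5.1.2] -/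
theorem cmInert_iff_mod_four_eq_three_of_j_eq_1728 (hp2 : p ≠ 2) (hj : W.j = 1728) :
    CMInert W p ↔ p % 4 = 3 := by
  have hpr : p.Prime := hp.out
  have hd : cmFieldDiscrOfJ W.j = -4 := by rw [hj]; norm_num [cmFieldDiscrOfJ]
  have hcast : ((cmFieldDiscrOfJ W.j : ℤ) : ZMod p) = -4 := by rw [hd]; push_cast; ring
  have hndvd : ¬ (p : ℤ) ∣ cmFieldDiscrOfJ W.j := by
    rw [hd]
    intro h
    have h' : p ∣ 4 := by exact_mod_cast (dvd_neg.mp h)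
    have h2 : p ∣ 2 := by
      have : p ∣ 2 * 2 := by simpa using h'
      exact (hpr.dvd_mul.mp this).elim id id
    exact hp2 ((Nat.prime_dvd_prime_iff_eq hpr Nat.prime_two).mp h2)
  unfold CMInert CMRamified
  rw [not_cmSplit_iff_of_ne_two hp2, hcast, isSquare_neg_four_iff hp2, not_not]
  constructor
  · rintro ⟨-, h | h⟩
    · exact absurd h hndvd
    · exact h
  · exact fun h ↦ ⟨hndvd, Or.inr h⟩

end CMField

/-! ### §2 The local types of the inert-bad core -/

section Core

variable (W : WeierstrassCurve ℚ) [W.IsElliptic] (p : ℕ) [hp : Fact p.Prime]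

/-- An X12 pair at `p ≥ 5` is BAD at the place `v` over `p` (`not_good_of_classX12_of_five_le`,
transported from the prime predicate `Good W p` to `HasGoodReductionAt v` by the tree's
`hasGoodReductionAtPrime_iff_hasGoodReductionAt_ringOfIntegers`). [cite: SilvermanAEC2009, VII.5 Prop. 5.1(a) and Cor. VII.7.2] -/
theorem not_hasGoodReductionAt_of_classX12_of_five_le (hX : ClassX12 W p) (hp5 : 5 ≤ p)
    (v : HeightOneSpectrum (𝓞 ℚ)) (hv : natGenerator v = p) : ¬ W.HasGoodReductionAt v := by
  have hng : ¬ Good W p := not_good_of_classX12_of_five_le W p hX hp5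
  rw [← hasGoodReductionAtPrime_iff_hasGoodReductionAt_ringOfIntegers v W]
  subst hv
  convert hng
  rfl

/-- **The local type of an inert-bad X12 pair.** For `W/ℚ` in class X12 at a prime `p ≥ 5` INERT in
the CM field (so bad at `p`: the O10 core of HOME `CLASS-CLOSURE-PLAN.md` §3.14), at the place `v`
over `p`: either `j = 0`, `p ≡ 2 (mod 3)` and the Kodaira type is `II, IV, I₀*, IV*` or `II*`; or
`j = 1728`, `p ≡ 3 (mod 4)` and the type is `III, I₀*` or `III*`; or `j ∉ {0, 1728}` and the type is
`I₀*`. [cite: SilvermanATAEC1994, IV.9.4, Table 4.1 and App. A §3] [cite: Cox2013, Prop. 5.16 and Cor. 5.17] -/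
theorem localType_of_classX12_of_cmInert (hX : ClassX12 W p) (hp5 : 5 ≤ p) (hin : CMInert W p)
    (v : HeightOneSpectrum (𝓞 ℚ)) (hv : natGenerator v = p) :
    (W.j = 0 ∧ p % 3 = 2 ∧ (W.kodairaSymbolAt v = .II ∨ W.kodairaSymbolAt v = .IV ∨
        W.kodairaSymbolAt v = .Istar 0 ∨ W.kodairaSymbolAt v = .IVstar ∨ W.kodairaSymbolAt v = .IIstar)) ∨
      (W.j = 1728 ∧ p % 4 = 3 ∧ (W.kodairaSymbolAt v = .III ∨ W.kodairaSymbolAt v = .Istar 0 ∨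
        W.kodairaSymbolAt v = .IIIstar)) ∨
      (W.j ≠ 0 ∧ W.j ≠ 1728 ∧ W.kodairaSymbolAt v = .Istar 0) := by
  have hbad := not_hasGoodReductionAt_of_classX12_of_five_le W p hX hp5 v hv
  rcases kodairaSymbolAt_of_classX12_of_bad W p hX hp5 hin.1 v hv hbad with
    ⟨hj, hk⟩ | ⟨hj, hk⟩ | h
  · exact Or.inl ⟨hj, (cmInert_iff_mod_three_eq_two_of_j_eq_zero W p (by omega) (by omega) hj).mp
      hin, hk⟩
  · exact Or.inr (Or.inl ⟨hj, (cmInert_iff_mod_four_eq_three_of_j_eq_1728 W p (by omega) hj).mp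
      hin, hk⟩)
  · exact Or.inr (Or.inr h)

/-- **`e ∣ p + 1` on the inert-bad core** (O10-TARGET §1 (i), proved): for an X12 pair at a prime
`p ≥ 5` inert in the CM field, the semistability defect read off the Kodaira type at the place over
`p` divides `p + 1`: types `II, II*` (`e = 6`) and `IV, IV*` (`e = 3`) force `6 ∣ p + 1`; types
`III, III*` (`e = 4`) force `4 ∣ p + 1`; and `2 ∣ p + 1` always (`e = 2`, type `I₀*`). Hence the
tame character `χ_p` of the pair factors through `𝔽_{p²}^×/𝔽_p^×` and the local problems
`(Rubin_η)` are indexed by `(p, e, ±)` with `e ∣ p + 1`. [cite: SilvermanATAEC1994, IV.9.4, Table 4.1 and App. A §3] [cite: Cox2013, Prop. 5.16 and Cor. 5.17] -/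
theorem semistabilityDefect_dvd_succ_of_classX12_of_cmInert (hX : ClassX12 W p) (hp5 : 5 ≤ p)
    (hin : CMInert W p) (v : HeightOneSpectrum (𝓞 ℚ)) (hv : natGenerator v = p) :
    ((W.kodairaSymbolAt v = .II ∨ W.kodairaSymbolAt v = .IIstar ∨ W.kodairaSymbolAt v = .IV ∨
        W.kodairaSymbolAt v = .IVstar) → 6 ∣ p + 1) ∧
      ((W.kodairaSymbolAt v = .III ∨ W.kodairaSymbolAt v = .IIIstar) → 4 ∣ p + 1) ∧
      2 ∣ p + 1 := by
  have hpr : p.Prime := hp.out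
  have hodd : p % 2 = 1 := Nat.odd_iff.mp (hpr.odd_of_ne_two (by omega))
  rcases localType_of_classX12_of_cmInert W p hX hp5 hin v hv with
    ⟨-, h3, hk⟩ | ⟨-, h4, hk⟩ | ⟨-, -, hk⟩
  · refine ⟨fun _ ↦ by omega, fun h ↦ ?_, by omega⟩
    exfalso
    rcases h with h | h <;> rw [h] at hk <;> simp at hk
  · refine ⟨fun h ↦ ?_, fun _ ↦ by omega, by omega⟩
    exfalso
    rcases h with h | h | h | h <;> rw [h] at hk <;> simp at hk
  · refine ⟨fun h ↦ ?_, fun h ↦ ?_, by omega⟩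
    · exfalso
      rcases h with h | h | h | h <;> rw [h] at hk <;> simp at hk
    · exfalso
      rcases h with h | h <;> rw [h] at hk <;> simp at hk

end Core

end Summit.BirchSwinnertonDyer.Rank1Residual.X12

end
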